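import Literature.AlgebraicGeometry.ModuliOfAbelianVarieties.SiegelAdmissibleOfIso
import HarnessLib

/-!
# Transport of an adelic marking along an isomorphism of complex abelian varieties WITH ITS TORUS MAP EXPOSED
# ([Milne2005ShimuraVarieties] §6 Thm. 6.11; [SerreGAGA1956] §2)

Topic `Literature/AlgebraicGeometry/ModuliOfAbelianVarieties`; namespace `Literature.AlgebraicGeometry.ModuliOfAbelianVarieties.SiegelAdelicMarking`.
THEOREMS ONLY (no definition, no named fact, no instance, no notation, no `sorry`).  Sequel of ★ `SiegelAdmissibleOfIso` §1
(`SiegelAdelicMarking.exists_of_iso`, which exposes only the lattice frame `γ` and the torsion parametrisation `r` of the transported marking).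
Cell `hodgecm-mathlib` (D-0151), FLOOR 0, P6 «MOD» (crux hLiu418 = stmt-HodgeConjecture-24832, `--supports`), organ **RD-T0** of the E6 closer of
`Cruxes/HLiu418/Lines/F0_P6a_PELWitnessE.lean` (socket Σ-AN `ReadsCReading`, census `CENSUS-SigmaAN.v1` row RD; E6 heir A-p06 (g33)): the READING clause of
`ReadsC` pins THE admissible marking by its complex coordinates `Ψ = Π_Z` and reads the `𝒪_F`-action through its TORUS MAP `toFun`, so every transport of
the (ADM)-package of ★ P-3 between fibre models (`P_T` at `φT t` ⟶ `P` at `x`) must carry `Ψ` and `toFun` along, not only `γ` and `r`.  HC_CM is proved only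
modulo the printed citations (2 remaining named inputs hLiu418 24832, h413 24833) until rung 0 closes; this file is generic and changes no count.

THE MATHEMATICS ([Milne2005ShimuraVarieties] Thm. 6.11: the class of `(A, s, ηK)` depends only on the isomorphism class; [SerreGAGA1956] §2: `X ↦ X^h` is a
functor).  A marking `m` of `A` by `[J, a]` pushes forward along `e : A ≅ B` to the marking `e_* m` of `B` with the SAME lattice frame `γ`, the SAME complex
coordinates `Ψ` (so the same model torus `ℂ^g ∕ Ψ ℤ^{2g}` — the carrier `(ℝ∕ℤ)^{2g}` of ★ `ComplexTorus Ψ` does not depend on `Ψ`), torus map `e(ℂ) ∘ toFun`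
and torsion parametrisation `e(ℂ) ∘ r`.

* §1 `exists_of_iso_toFun_eq` — ★ `exists_of_iso` with `Ψ′ = Ψ` and `toFun′ = e(ℂ) ∘ toFun` exposed.
* §2 (ED. 2) **`exists_admPackage_of_fibreIso`** — the whole (ADM)-package `(m, Θ, Λ; ample, λ̄ = Λ(𝒪(Θ)), tower)` of a triple `P` at a field point `s` transports
  along a fibre isomorphism `e : P′_{s′} ≅ P_s` carrying level sections and polarisation witnesses to a package of `P′` at `s′`, WITH `γ′ = γ`, `Ψ′ = Ψ`,
  `toFun′ = e⁻¹(ℂ) ∘ toFun` (★ `isAdmissibleAt_of_fibreIso` generalised from `(Spec ℂ, 𝟙)` to arbitrary `(S, s)`, `(S′, s′)` and with the marking exposed).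

## References
* [Milne2005ShimuraVarieties] J. S. Milne, *Introduction to Shimura Varieties* (2005; rev. 2017), §6 Thm. 6.11 pp. 74–75.
* [SerreGAGA1956] J.-P. Serre, *Géométrie algébrique et géométrie analytique*, Ann. Inst. Fourier 6 (1956), §2.
-/

set_option autoImplicit false

noncomputable section

open CategoryTheory CategoryTheory.Limits AlgebraicGeometry Matrix Topology

namespace Literature.AlgebraicGeometry.ModuliOfAbelianVarieties

open Literature.AlgebraicGeometry.Motives (SchemeOver ComplexPoints AlgPoints specOver AbelianVariety CartierDivisor)
open Literature.Geometry.Kaehler (ComplexTorus)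
open Literature.NumberTheory.Transcendental (IsAnalytification)

namespace SiegelAdelicMarking

variable {g : ℕ} {δ : Fin g → ℕ} {J : C0pm δ} {a : gspFinAdelic δ} {A B : AbelianVariety ℂ}

/-- **Push-forward of a marking along an isomorphism, with frame, coordinates and torus map exposed**: for `m` a marking of `A` by `[J, a]` and
`e : A ≅ B` there is a marking `m′` of `B` by `[J, a]` with `γ′ = γ`, `Ψ′ = Ψ`, `toFun′ t = e(ℂ) (toFun t)` for every `t` in the model torus (the
carrier of ★ `ComplexTorus` is `(ℝ∕ℤ)^{2g}` for every `Ψ`), and `r′ v = e(ℂ) (r v)` (the construction of ★ `exists_of_iso`: analytification transported by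
★ `IsAnalytification.transport_iso`). [cite: Milne2005ShimuraVarieties, §6 Thm. 6.11 pp. 74–75] [cite: SerreGAGA1956, §2] -/
theorem exists_of_iso_toFun_eq (m : SiegelAdelicMarking J a A) (e : A ≅ B) :
    ∃ m' : SiegelAdelicMarking J a B, m'.γ = m.γ ∧ m'.Ψ = m.Ψ ∧
      (∀ t : ComplexTorus m.Ψ, m'.toFun t = AlgPoints.map e.hom.hom.hom.hom (m.toFun t)) ∧
      ∀ v : Fin g ⊕ Fin g → ℚ, m'.r v = AlgPoints.map e.hom.hom.hom.hom (m.r v) := by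
  -- adapted from ★ `SiegelAdmissibleOfIso.exists_of_iso` (same record; the two extra clauses are `rfl`)
  have hdim : A.dim = B.dim := by
    haveI : IsIso (AbelianVariety.Hom.toSchemeHom e.hom) :=
      ⟨AbelianVariety.Hom.toSchemeHom e.inv,
        by rw [← AbelianVariety.toSchemeHom_comp, e.hom_inv_id]; rfl,
        by rw [← AbelianVariety.toSchemeHom_comp, e.inv_hom_id]; rfl⟩
    exact AbelianVariety.dim_eq_of_isIsogeny (f := e.hom) ⟨inferInstance, inferInstance⟩
  have han : IsAnalytification (Fin g → ℂ) B.X B.dim (AlgPoints.map e.hom.hom.hom.hom ∘ m.toFun) := by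
    rw [← hdim]
    exact m.isAnalytification.transport_iso (AbelianVariety.overIsoOfIso e)
  let fwd : A.Points ℂ →* B.Points ℂ := IsMonHom.monoidHom e.hom.hom.hom.hom (specOver ℂ ℂ)
  have hfwd : ∀ P, fwd P = AlgPoints.map e.hom.hom.hom.hom P := fun P => rfl
  refine ⟨{ γ := m.γ
            γ_isLatticeBasis := m.γ_isLatticeBasis
            Ψ := m.Ψ
            Ψ_J := m.Ψ_J
            toFun := AlgPoints.map e.hom.hom.hom.hom ∘ m.toFun
            isAnalytification := han
            toFun_add := fun x y => by
              simp only [Function.comp_apply, m.toFun_add, ← hfwd, map_mul] }, rfl, rfl, fun t => rfl, fun v => ?_⟩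
  rw [SiegelAdelicMarking.r_def, SiegelAdelicMarking.r_def]
  rfl

/-! ### §2 (ED. 2) Transport of the whole (ADM)-package along a fibre isomorphism, marking exposed -/

section Package

open Literature.AlgebraicGeometry.AbelianSchemes (PolarizedAbelianSchemeWithLevel AbelianSchemeOver)
open Literature.NumberTheory.Automorphic (siegelUpperHalfSpace)
open SiegelModuli (jOfSiegel)

variable {g N : ℕ} {δ : Fin g → ℕ} {S S' : Scheme.{0}} {P : PolarizedAbelianSchemeWithLevel g N δ S}
  {P' : PolarizedAbelianSchemeWithLevel g N δ S'} {s : Spec (.of ℂ) ⟶ S} {s' : Spec (.of ℂ) ⟶ S'}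

/-- **TRANSPORT OF THE (ADM)-PACKAGE ALONG A FIBRE ISOMORPHISM, MARKING EXPOSED.**  `P` over `S`, `P′` over `S′` polarized abelian schemes with level-`N`
structure, `s`, `s′` complex points, `e : P′_{s′} ≅ P_s` an isomorphism of the fibre abelian varieties carrying the level sections of `P′` at `s′` to those of
`P` at `s` (`he`) and ample `IsLambdaOfAt`-witnesses of `P` back to such witnesses of `P′` (`hpol`, the shape of ★ `isAdmissibleAt_of_fibreIso`).  Then an
(ADM)-package of `P` at `s` for `(Z, r)` — marking `m`, ample `Θ` with `λ̄ = Λ(𝒪(Θ))`, symplectic lift `Λ` whose tower read through `r` is `m.r` — yields an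
(ADM)-package `(m′, e^*Θ, Λ′)` of `P′` at `s′` for the same `(Z, r)` with THE SAME FRAME AND COORDINATES and torus map `toFun′ = e⁻¹(ℂ) ∘ toFun` (§1 along
`e⁻¹`; ★ `SymplecticLift.exists_transport_lift_eq`).  In RD of the E6 closer: `P := P_{X_q}` at `φT t` (the ★ P-3 package) and `P′ := P` at `x`, or the two
fibre-at-`𝟙` models in between.
[cite: Milne2005ShimuraVarieties, §6 Thm. 6.11 pp. 74–75] [cite: MumfordFogartyKirwan1994, Ch. 7 §2 Definition 7.2 (p. 129)]
[cite: Lan2013PELCompactifications, §1.3.6 Lemma 1.3.6.5 (p. 81)] -/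
theorem exists_admPackage_of_fibreIso (hδ : IsPolarizationType δ) {r : gspFinAdelic δ}
    {Z : Matrix (Fin g) (Fin g) ℂ} {hZ : Z ∈ siegelUpperHalfSpace g}
    (e : (P'.A.fibre s').toAbelianVariety ≅ (P.A.fibre s).toAbelianVariety)
    (he : ∀ i : Fin g ⊕ Fin g,
      AlgPoints.map e.hom.hom.hom.hom (P'.A.restrictPt s' (P'.level.σ i)) = P.A.restrictPt s (P.level.σ i))
    (hpol : ∀ Θ : CartierDivisor (P.A.fibre s).toAbelianVariety.X.left,
      Θ.IsAmple → P.A.IsLambdaOfAt s P.D P.pol.lam Θ →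
        haveI := AbelianVariety.isDominant_toSchemeHom_iso_hom e
        (Θ.pullback (AbelianVariety.Hom.toSchemeHom e.hom)).IsAmple ∧
          P'.A.IsLambdaOfAt s' P'.D P'.pol.lam (Θ.pullback (AbelianVariety.Hom.toSchemeHom e.hom)))
    (m : SiegelAdelicMarking ⟨jOfSiegel δ Z, SiegelComplexRecordSystem.jOfSiegel_mem_C0pm hδ.1 hZ⟩ r (P.A.fibre s).toAbelianVariety)
    (Θ : CartierDivisor (P.A.fibre s).toAbelianVariety.X.left) (Λ : P.level.SymplecticLift s Θ δ)
    (hample : Θ.IsAmple) (hlam : P.A.IsLambdaOfAt s P.D P.pol.lam Θ)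
    (htower : ∀ ⦃M : ℕ⦄, N ∣ M → M ≠ 0 → ∀ (x : Fin g ⊕ Fin g → ZMod M) (v : Fin g ⊕ Fin g → ℚ),
      AdelicCongr ((r⁻¹ : gspFinAdelic δ) : GL (Fin g ⊕ Fin g) finAdeleQ) 1 v (fun i => ((x i).val : ℚ) / M) →
        ((Λ.lift M (Multiplicative.ofAdd x)) : (P.A.fibre s).toAbelianVariety.Points ℂ) = m.r v) :
    ∃ (m' : SiegelAdelicMarking ⟨jOfSiegel δ Z, SiegelComplexRecordSystem.jOfSiegel_mem_C0pm hδ.1 hZ⟩ r (P'.A.fibre s').toAbelianVariety)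
      (Θ' : CartierDivisor (P'.A.fibre s').toAbelianVariety.X.left) (Λ' : P'.level.SymplecticLift s' Θ' δ),
      Θ'.IsAmple ∧ P'.A.IsLambdaOfAt s' P'.D P'.pol.lam Θ' ∧
      (∀ ⦃M : ℕ⦄, N ∣ M → M ≠ 0 → ∀ (x : Fin g ⊕ Fin g → ZMod M) (v : Fin g ⊕ Fin g → ℚ),
        AdelicCongr ((r⁻¹ : gspFinAdelic δ) : GL (Fin g ⊕ Fin g) finAdeleQ) 1 v (fun i => ((x i).val : ℚ) / M) →
          ((Λ'.lift M (Multiplicative.ofAdd x)) : (P'.A.fibre s').toAbelianVariety.Points ℂ) = m'.r v) ∧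
      m'.γ = m.γ ∧ m'.Ψ = m.Ψ ∧ ∀ t : ComplexTorus m.Ψ, m'.toFun t = AlgPoints.map e.inv.hom.hom.hom (m.toFun t) := by
  -- adapted from ★ `SiegelAdmissibleOfIso.isAdmissibleAt_of_fibreIso` (B-p06∕U-DAG), bases generalised, marking exposed by §1
  haveI := AbelianVariety.isDominant_toSchemeHom_iso_hom e
  -- §1 along `e⁻¹`: the marking of `P_s` pushes forward to `P′_{s′}`
  obtain ⟨m', hγ, hΨ, htoFun, hr⟩ := m.exists_of_iso_toFun_eq e.symm
  -- the polarisation witness `e^*Θ`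
  obtain ⟨hample', hlam'⟩ := hpol Θ hample hlam
  -- the symplectic lift transports with tower `e⁻¹ ∘ lift`
  obtain ⟨Λ', -, hΛ'⟩ :=
    AbelianSchemeOver.LevelStructure.SymplecticLift.exists_transport_lift_eq (φ := P.level) (φ' := P'.level) e he Λ
  refine ⟨m', Θ.pullback (AbelianVariety.Hom.toSchemeHom e.hom), Λ', hample', hlam', ?_, hγ, hΨ, fun t => htoFun t⟩
  intro M hNM hM0 x v hv
  rw [hΛ', htower hNM hM0 x v hv, hr v]
  rfl

end Package

end SiegelAdelicMarking

end Literature.AlgebraicGeometry.ModuliOfAbelianVarieties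

end
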